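import Literature.AnabelianGeometry.EtaleTheta.ArithThetaTowerFrobenioidLaws
import HarnessLib

/-!
# [IUTchI] Ex. 3.2 (iii) / [EtTh] Cor. 3.8 (ii) AT THE TERM `ℱ̲_v̲ = temperedFrobenioid d T`: the divisor monoid `Φ` is
# NON-DILATING at every object, BINDER-FREE — GAP A item GA-08 (D8, part 1), the H+ branch DISCHARGED at the model carrier

S. Mochizuki, *The étale theta function …*, Publ. RIMS **45** (2009) [MochizukiEtTh2009], Def. 3.6 (ii) pp.76–77, Thm. 3.7 (ii)
p.79 («Suppose `𝒟` is of FSMFF-type, and that `Φ` is non-dilating. Then `𝒞` is of standard type»), Cor. 3.8 (ii) pp.80–81;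
*The geometry of Frobenioids I*, Kyushu J. Math. **62** (2008) [MochizukiFrdI2008], Def. 1.1 (i)/(ii) p.19 («non-dilating»),
Def. 3.1 (i) p.56 («standard type»); *Inter-universal Teichmüller Theory I* [Mochizuki2012], Ex. 3.2 (iii) p.71
[claim: Mochizuki2012, status: disputed — nothing of the series is asserted here] [cite: MochizukiEtTh2009, Cor 3.8 p.80].

GAP A of record G-L5-EX32I-1 (abc-iut cell), row **GA-08** = D8 part 1 of GAP-SIZING-A.md 69de97346848d3e8 («hnd — H+ expected,
binder-free»); ruled shapes `plan/L5/GAP-A-SIGNATURES.md` v2 bd8d4ceaa15d54d7 §5/§8 (D8: `isNonDilating_of_carrierSpec (_hC) (hD)`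
★ p671252; D4/F3: `temperedFrobenioid d T`, `carrierSpec_temperedFrobenioid d T`, `pullDichotomy_temperedFrobenioid d T` ★ p675527);
RULINGS #319 (branches H+/H−), #339 (1)–(3) (pull dichotomy, no finite-index hypothesis), #341 (C), #345 (C), #353 (A).  This file is a
PROOF-ONLY ADD-ON riding on row GA-08 (no new row, no new binder, no ruled signature touched): it records IN THE KERNEL, by name and with
NO hypothesis beyond the shared §0 binders `(d) (T)` + `[IsTopologicalGroup P]`, that the H+ branch of D8 HOLDS AT THE TERM —

* **`ArithThetaTower.isNonDilating_temperedFrobenioid (d) (T) : ∀ (A : T.Dvᵒᵖ) (f : A ⟶ A),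
  treeMonoidVocabWeak.IsNonDilating ((temperedFrobenioid d T).Φ.carrier A) ((temperedFrobenioid d T).Φ.pull f)`** — the `hnd` instance
  hypothesis of [EtTh] Cor. 3.8 (ii) / the `hnd` binder of `BadLocalFrobenioid.cFromF_ofKits_toInput` and of
  `hull_selfEquivalence_of_carrierSpec` AT THE MODEL CARRIER, every object, every endomorphism: GA-08's ruled
  `isNonDilating_of_carrierSpec` (★ p671252) at `hC := carrierSpec_temperedFrobenioid d T`, `hD := pullDichotomy_temperedFrobenioid d T`
  (GA-12 F3 ★ p675527 — `hD` is a THEOREM there: GA-10's `U`-orbit dichotomy `Envelope.phiZeroPull_dichotomy` ★ p672771 on the geometric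
  lattice, the identity on the `ord(𝒪^▷)` coordinate by GA-01's `valuation_gal_eq`, transported to `Φ(U) ≅ Φ₀(U)^pf` by GA-08's
  `CarrierSpec.pullDichotomy_of_lattice`), composed BY NAME; this is the term GA-07's knit passes as `hnd`;
* `isNonDilatingOn_divisorMonoid_temperedFrobenioid` — the same in the functorial form `IsNonDilatingOn Φ` of [FrdI] Def. 1.1 (ii);
* **`isOfStandardType_temperedFrobenioid (d) (T) : (temperedFrobenioid d T).opsData.IsOfStandardType`** — [EtTh] Thm. 3.7 (ii), first
  clause, AT THE TERM: `𝒟_v̲ = CosetCat Π_v̲` is of FSMFF-type (`BadLocalFrobenioid.isOfFSMFFType_Dv`) and `Φ` is non-dilating, so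
  `ℱ̲_v̲` is of standard type ([FrdI] Def. 3.1 (i)).

HONEST FRAMING: three one-line compositions BY NAME of landed theorems at OUR typed objects — the term is GA-12's inhabitant of OUR spec S0
over GA-10's DECREED, LABELLED finite-level envelope with GENUINE constants ((c3′) carrier label and GUARD #322 as on `temperedFrobenioid`'s
docstring: NOT print's `ℱ̲_v̲` of an actual Tate curve; [EtTh] Def. 3.3 `Φ` at general `U` and the Kummer levels = FOUNDATIONS 13/14, not
claimed); «H+ at the term» is a statement about THAT object; typed ≠ inhabited-in-print ≠ proved-in-print ≠ tokened; an UNDISPUTED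
construction around [IUTchIII] Cor. 3.12, which stays OPEN by charter (D-0045) — no side is taken on it or on any author; nothing here
asserts the abc conjecture proved or refuted; COUNT-NEUTRAL (tokens move only by a chair RULINGS line on the headline rows).
No definition, no instance, no notation, no attribute manipulation, no `sorry`.
-/

namespace Literature.AnabelianGeometry.EtaleTheta

namespace ArithThetaTower

open CategoryTheory Opposite Literature.AlgebraicGeometry.Frobenioids Literature.IUT.HodgeTheaters

variable {p : ℕ} [Fact p.Prime] (d : GaloisValDatum.{0} p) {P : Type} [Group P] [TopologicalSpace P]
  [IsTopologicalGroup P] (T : BadLocalGroupDatum d.Gal P)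

/-- **D8, branch H+, AT THE TERM (GAP A item GA-08): the divisor monoid `Φ` of `ℱ̲_v̲ = temperedFrobenioid d T` is NON-DILATING
along every endomorphism of every object of `𝒟_v̲ = CosetCat Π_v̲`** ([FrdI] Def. 1.1 (i): `Φ(f)^char = id` as soon as
`Φ(f)^char(a) ≼ a` for every primary `a`) — the `hnd` instance hypothesis of [EtTh] Cor. 3.8 (ii) DISCHARGED at the model carrier with
NO hypothesis beyond the shared binders: GA-08's ruled `isNonDilating_of_carrierSpec` (★ p671252) at GA-12's
`carrierSpec_temperedFrobenioid d T` / `pullDichotomy_temperedFrobenioid d T` (★ p675527), BY NAME (RULINGS #319 H+, #339 (2)/(3)).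
A statement about OUR typed term ((c3′) label, GUARD #322); no side on [IUTchIII] Cor. 3.12; NOT an abc claim.
[cite: MochizukiEtTh2009, Cor 3.8 (ii) p.80] -/
theorem isNonDilating_temperedFrobenioid :
    ∀ (A : T.Dvᵒᵖ) (f : A ⟶ A),
      treeMonoidVocabWeak.IsNonDilating ((temperedFrobenioid d T).Φ.carrier A) ((temperedFrobenioid d T).Φ.pull f) :=
  isNonDilating_of_carrierSpec (carrierSpec_temperedFrobenioid d T) (pullDichotomy_temperedFrobenioid d T)

/-- **`Φ` of `ℱ̲_v̲ = temperedFrobenioid d T` is non-dilating in the functorial form of [FrdI] Def. 1.1 (ii)** (`IsNonDilatingOn Φ`: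
the pull-back along every endomorphism of every object of `𝒟_v̲` is a non-dilating endomorphism of `Φ(A)`) — GA-08's
`isNonDilatingOn_divisorMonoid_of_carrierSpec` at the term, BY NAME.  A statement about OUR typed term; NOT an abc claim.
[cite: MochizukiFrdI2008, Def. 1.1 (ii) p.19] -/
theorem isNonDilatingOn_divisorMonoid_temperedFrobenioid : IsNonDilatingOn (temperedFrobenioid d T).divisorMonoid :=
  isNonDilatingOn_divisorMonoid_of_carrierSpec (carrierSpec_temperedFrobenioid d T) (pullDichotomy_temperedFrobenioid d T)

/-- **[EtTh] Thm. 3.7 (ii), first clause, AT THE TERM: `ℱ̲_v̲ = temperedFrobenioid d T` is of STANDARD type** ([FrdI] Def. 3.1 (i),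
`PreFrobenioidData.IsOfStandardType` at `opsData`) — «Suppose `𝒟` is of FSMFF-type, and that `Φ` is non-dilating. Then `𝒞` is of
standard type»: `𝒟_v̲ = CosetCat Π_v̲` is of FSMFF-type (`BadLocalFrobenioid.isOfFSMFFType_Dv`) and `Φ` is non-dilating
(`isNonDilating_temperedFrobenioid`); GA-08's `isOfStandardType_of_carrierSpec` at the term, BY NAME.  A statement about OUR typed term
((c3′) label, GUARD #322); no side on [IUTchIII] Cor. 3.12; NOT an abc claim. [cite: MochizukiEtTh2009, Thm 3.7 (ii) p.79] -/
theorem isOfStandardType_temperedFrobenioid : (temperedFrobenioid d T).opsData.IsOfStandardType :=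
  isOfStandardType_of_carrierSpec (carrierSpec_temperedFrobenioid d T) (pullDichotomy_temperedFrobenioid d T)

end ArithThetaTower

end Literature.AnabelianGeometry.EtaleTheta
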